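import Summits.FinalStateConjecture.FinalStateConjecture.Theorems.EIHFluxBalanceInertialRecessionKerrBounds
import Summits.FinalStateConjecture.FinalStateConjecture.Theorems.EIHFluxBalanceInertialRecessionCalculus
import Summits.FinalStateConjecture.FinalStateConjecture.Theorems.EIHFluxBalanceInertialRecessionLorentz

/-!
# Route EIHFluxBalance — `InertialRecession`: the frame defect and the model defect of a hole chart

Helper file for the crux `stmt-FinalStateConjecture-10166`
(`Summit.FinalStateConjecture.FinalStateConjecture.Theses.EIHFluxBalance.InertialRecession`).

For the hole chart `Φ ∘ A` of an `a = 0` hole (honest placement `A`, final frame `Λ∞`), the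
painted one-hole field transported by `DA` is `g_{M,0}(Λ∞⁻¹x')[S ·, S ·]` with the **frame map**
`S(x') = boost(−v(t)) ∘ DA(x')`, `t = x'⁰`, while the model is `g_{M,0}(Λ∞⁻¹x')[Λ∞⁻¹ ·, Λ∞⁻¹ ·]`.
This file bounds, pointwise and in `C²`, the **frame defect** `E = S − Λ∞⁻¹` by the painted
kinematics (`‖DA − 1‖`, `‖D²A‖`, `‖D³A‖`, `‖a(t) − aInf‖`, `‖a'‖`, `‖a''‖` for
`a(t) = boost(−v(t))`) and the resulting **model defect**
`T = K[S ·, S ·] − K[Λ∞⁻¹ ·, Λ∞⁻¹ ·] = K[E ·, Λ∞⁻¹ ·] + K[Λ∞⁻¹ ·, E ·] + K[E ·, E ·]` by `C · δ`: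
* `norm_iteratedFDeriv_bilinearComp_le_of_bounds` — trilinear Leibniz estimate
  `‖Dᵏ (F[P ·, Q ·])‖ ≤ 4ᵏ C_F C_P C_Q`;
* `norm_iteratedFDeriv_kerrComp_le` — `Cᵏ` bounds of `x' ↦ g_{M,0}(Λ x')` on `{‖(Λx')~‖ ≥ r₀}`;
* `norm_iteratedFDeriv_frameDefect_le'` (registered form unprimed) — `‖Dᵏ E‖ ≤ (4 + C_a) δ` (`k ≤ 2`);
* `norm_iteratedFDeriv_modelDefect_le'` (registered form unprimed) — `‖Dᵏ T‖ ≤ 16 C_K (2‖Λ∞⁻¹‖ + 5 + C_a)(4 + C_a) δ`.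
-/

noncomputable section

open scoped Topology ContDiff BigOperators
open Filter Set Function TopologicalSpace Literature.Geometry.Lorentzian

namespace Summit.FinalStateConjecture.FinalStateConjecture.Theorems

/-! ### Trilinear Leibniz estimate -/

/-- **Trilinear Leibniz estimate.** For `F` smooth on an open set `W ∋ x` and `P`, `Q` smooth,
with `‖Dⁱ F(x)‖ ≤ C_F`, `‖Dⁱ P(x)‖ ≤ C_P`, `‖Dⁱ Q(x)‖ ≤ C_Q` for `i ≤ k`:
`‖Dᵏ (y ↦ F(y)[P(y) ·, Q(y) ·])(x)‖ ≤ 4ᵏ C_F C_P C_Q`. [folklore] -/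
theorem norm_iteratedFDeriv_bilinearComp_le_of_bounds {F : E4 → E4 →L[ℝ] E4 →L[ℝ] ℝ}
    {P Q : E4 → E4 →L[ℝ] E4} {W : Set E4} (hW : IsOpen W) (hF : ContDiffOn ℝ ∞ F W)
    (hP : ContDiff ℝ ∞ P) (hQ : ContDiff ℝ ∞ Q) {x : E4} (hx : x ∈ W) (k : ℕ) {CF CP CQ : ℝ}
    (hCF : ∀ i ≤ k, ‖iteratedFDeriv ℝ i F x‖ ≤ CF) (hCP : ∀ i ≤ k, ‖iteratedFDeriv ℝ i P x‖ ≤ CP)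
    (hCQ : ∀ i ≤ k, ‖iteratedFDeriv ℝ i Q x‖ ≤ CQ) :
    ‖iteratedFDeriv ℝ k (fun y ↦ (F y).bilinearComp (P y) (Q y)) x‖ ≤ 4 ^ k * CF * CP * CQ := by
  have hCF0 : 0 ≤ CF := (norm_nonneg _).trans (hCF 0 (Nat.zero_le _))
  have hCP0 : 0 ≤ CP := (norm_nonneg _).trans (hCP 0 (Nat.zero_le _))
  have hCQ0 : 0 ≤ CQ := (norm_nonneg _).trans (hCQ 0 (Nat.zero_le _))
  -- scalar slots
  have hPu : ∀ (u : E4) (l : ℕ), l ≤ k → ‖iteratedFDerivWithin ℝ l (fun y ↦ P y u) W x‖ ≤ CP * ‖u‖ := by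
    intro u l hl
    rw [iteratedFDerivWithin_of_isOpen l hW hx]
    refine (norm_iteratedFDeriv_clm_apply_const hP.contDiffAt (by exact_mod_cast le_top)).trans ?_
    rw [mul_comm]
    exact mul_le_mul_of_nonneg_right (hCP l hl) (norm_nonneg u)
  have hQu : ∀ (u : E4) (l : ℕ), l ≤ k → ‖iteratedFDerivWithin ℝ l (fun y ↦ Q y u) W x‖ ≤ CQ * ‖u‖ := by
    intro u l hl
    rw [iteratedFDerivWithin_of_isOpen l hW hx]
    refine (norm_iteratedFDeriv_clm_apply_const hQ.contDiffAt (by exact_mod_cast le_top)).trans ?_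
    rw [mul_comm]
    exact mul_le_mul_of_nonneg_right (hCQ l hl) (norm_nonneg u)
  have hFW : ∀ i ≤ k, ‖iteratedFDerivWithin ℝ i F W x‖ ≤ CF := fun i hi ↦ by
    rw [iteratedFDerivWithin_of_isOpen i hW hx]; exact hCF i hi
  -- first slot
  have hone : ∀ (u : E4) (i : ℕ), i ≤ k →
      ‖iteratedFDerivWithin ℝ i (fun y ↦ (F y) (P y u)) W x‖ ≤ 2 ^ i * CF * (CP * ‖u‖) := by
    intro u i hi
    have hPc : ContDiffOn ℝ ∞ (fun y ↦ P y u) W := (hP.clm_apply contDiff_const).contDiffOn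
    have h := norm_iteratedFDerivWithin_clm_apply (𝕜 := ℝ) (f := F) (g := fun y ↦ P y u) (n := i)
      (N := ∞) hF hPc hW.uniqueDiffOn hx (by exact_mod_cast le_top)
    exact h.trans (sum_choose_mul_mul_le hCF0 (fun l hl ↦ hFW l (hl.trans hi)) (fun _ ↦ norm_nonneg _)
      (fun l hl ↦ hPu u l (hl.trans hi)))
  -- both slots
  have htwo : ∀ u w : E4, ‖iteratedFDeriv ℝ k (fun y ↦ (F y) (P y u) (Q y w)) x‖ ≤
      4 ^ k * CF * CP * CQ * ‖u‖ * ‖w‖ := by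
    intro u w
    have hcd : ContDiffOn ℝ ∞ (fun y ↦ (F y) (P y u)) W :=
      hF.clm_apply (hP.clm_apply contDiff_const).contDiffOn
    have hQc : ContDiffOn ℝ ∞ (fun y ↦ Q y w) W := (hQ.clm_apply contDiff_const).contDiffOn
    have h := norm_iteratedFDerivWithin_clm_apply (𝕜 := ℝ) (f := fun y ↦ (F y) (P y u))
      (g := fun y ↦ Q y w) (n := k) (N := ∞) hcd hQc hW.uniqueDiffOn hx (by exact_mod_cast le_top)
    rw [iteratedFDerivWithin_of_isOpen k hW hx] at h
    refine h.trans ((sum_choose_mul_mul_le (α := 2 ^ k * CF * (CP * ‖u‖)) (by positivity)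
      (fun i hi ↦ ?_) (fun _ ↦ norm_nonneg _) (fun l hl ↦ hQu w l hl)).trans ?_)
    · refine (hone u i hi).trans ?_
      have h1 : (2 : ℝ) ^ i ≤ 2 ^ k := pow_le_pow_right₀ (by norm_num) hi
      exact mul_le_mul_of_nonneg_right (mul_le_mul_of_nonneg_right h1 hCF0) (by positivity)
    · have : (2 : ℝ) ^ k * (2 ^ k * CF * (CP * ‖u‖)) * (CQ * ‖w‖) =
          4 ^ k * CF * CP * CQ * ‖u‖ * ‖w‖ := by
        rw [show (4 : ℝ) ^ k = 2 ^ k * 2 ^ k by rw [← mul_pow]; norm_num]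
        ring
      rw [this]
  -- assemble
  have hGcd : ContDiffAt ℝ k (fun y ↦ (F y).bilinearComp (P y) (Q y)) x := by
    have h1 : ContDiffAt ℝ ∞ F x := (hF x hx).contDiffAt (hW.mem_nhds hx)
    have h2 : ContDiffAt ℝ ∞ (fun y ↦ (F y).comp (P y)) x := h1.clm_comp hP.contDiffAt
    have h3 := ContDiffAt.continuousLinearMap_comp (G := (E4 →L[ℝ] ℝ) →L[ℝ] (E4 →L[ℝ] ℝ))
      ((ContinuousLinearMap.compL ℝ E4 E4 ℝ).flip) hQ.contDiffAt (x := x)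
    have h4 := h3.clm_comp h2
    have hfun : (fun y ↦ (F y).bilinearComp (P y) (Q y)) =
        fun y ↦ ((ContinuousLinearMap.compL ℝ E4 E4 ℝ).flip (Q y)).comp ((F y).comp (P y)) := by
      funext y
      ext u w
      simp
    rw [hfun]
    exact h4.of_le (by exact_mod_cast le_top)
  refine norm_iteratedFDeriv_le_of_forall_apply₂ hGcd (by positivity) fun u w ↦ ?_
  have hfun : (fun y ↦ (F y).bilinearComp (P y) (Q y) u w) = fun y ↦ (F y) (P y u) (Q y w) := by
    funext y; rw [ContinuousLinearMap.bilinearComp_apply]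
  rw [hfun]
  exact htwo u w

/-! ### The transported Kerr–Schild form -/

/-- **`Cᵏ` bounds of `x' ↦ g_{M,0}(Λ x')`** for a fixed linear map `Λ` (here `Λ∞⁻¹`), on
`{‖(Λx')~‖ ≥ r₀}`: `‖Dⁱ‖ ≤ C_K max(1, ‖Λ‖)ᵏ` for `i ≤ k`, with the uniform bound `C_K` of
`…KerrBounds`. [folklore] -/
theorem norm_iteratedFDeriv_kerrComp_le (M : ℝ) {r₀ : ℝ} (hr₀ : 0 < r₀) (k : ℕ) :
    ∃ C : ℝ, 0 ≤ C ∧ ∀ (Λ : E4 →L[ℝ] E4) (x : E4), r₀ ≤ E4.spatialNorm (Λ x) → ∀ i ≤ k,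
      ‖iteratedFDeriv ℝ i (fun y ↦ Kerr.bilin M 0 (Λ y)) x‖ ≤ C * max 1 ‖Λ‖ ^ k := by
  obtain ⟨C, hC0, hC⟩ := exists_bound_iteratedFDeriv_kerr_zero_spin' M (half_pos hr₀) k
  refine ⟨C, hC0, fun Λ x hx i hi ↦ ?_⟩
  set s : Set E4 := {y | r₀ / 2 < E4.spatialNorm y} with hs
  have hso : IsOpen s := by
    refine isOpen_lt continuous_const ?_
    unfold E4.spatialNorm
    fun_prop
  have hxs : Λ x ∈ s := by show r₀ / 2 < _; linarith
  have hKs : ContDiffOn ℝ ∞ (fun y ↦ Kerr.bilin M 0 y) s := by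
    intro y hy
    have hrad : 0 < Kerr.radius 0 y := by
      rw [Kerr.radius_zero_left]; exact (half_pos hr₀).trans hy
    exact (Kerr.contDiffAt_bilin M 0 hrad).contDiffWithinAt
  have hpre : IsOpen (Λ ⁻¹' s) := hso.preimage Λ.continuous
  have key := Λ.iteratedFDerivWithin_comp_right (f := fun y ↦ Kerr.bilin M 0 y) hKs hso.uniqueDiffOn
    hpre.uniqueDiffOn hxs (i := i) (by exact_mod_cast le_top)
  rw [iteratedFDerivWithin_of_isOpen i hpre hxs, iteratedFDerivWithin_of_isOpen i hso hxs] at key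
  rw [show (fun y ↦ Kerr.bilin M 0 (Λ y)) = (fun y ↦ Kerr.bilin M 0 y) ∘ Λ from rfl, key]
  refine (ContinuousMultilinearMap.norm_compContinuousLinearMap_le _ _).trans ?_
  rw [Finset.prod_const, Finset.card_univ, Fintype.card_fin]
  have h1 := hC (Λ x) (by linarith) i hi
  have h2 : ‖Λ‖ ^ i ≤ max 1 ‖Λ‖ ^ k :=
    (pow_le_pow_left₀ (norm_nonneg _) (le_max_right _ _) i).trans
      (pow_le_pow_right₀ (le_max_left _ _) hi)
  exact mul_le_mul h1 h2 (by positivity) hC0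

/-! ### The frame defect -/

/-- **The frame defect** `E(x') = a(x'⁰) ∘ DA(x') − aInf` in `C²`: if `‖DA(x') − 1‖ ≤ δ`,
`‖DʲA(x')‖ ≤ δ` (`j = 2, 3`), `‖a(t)‖ ≤ C_a`, `‖a(t) − aInf‖ ≤ δ`, `‖a'(t)‖, ‖a''(t)‖ ≤ δ`
(`t = x'⁰`) with `δ ≤ 1`, then `‖Dᵏ E(x')‖ ≤ (4 + C_a) δ` for `k ≤ 2`. [folklore] -/
theorem norm_iteratedFDeriv_frameDefect_le' {a : ℝ → E4 →L[ℝ] E4} {A : E4 → E4}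
    (ha : ContDiff ℝ ∞ a) (hA : ContDiff ℝ ∞ A) (aInf : E4 →L[ℝ] E4) {x : E4} {δ Ca : ℝ}
    (hδ0 : 0 ≤ δ) (hδ1 : δ ≤ 1) (hCa : 0 ≤ Ca)
    (hDA : ‖fderiv ℝ A x - ContinuousLinearMap.id ℝ E4‖ ≤ δ)
    (hDk : ∀ j, 2 ≤ j → j ≤ 3 → ‖iteratedFDeriv ℝ j A x‖ ≤ δ) (ha0 : ‖a (x 0)‖ ≤ Ca)
    (haV : ‖a (x 0) - aInf‖ ≤ δ) (hak : ∀ i, 1 ≤ i → i ≤ 2 → ‖iteratedDeriv i a (x 0)‖ ≤ δ) :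
    ∀ k ≤ 2, ‖iteratedFDeriv ℝ k (fun y ↦ (a (y 0)).comp (fderiv ℝ A y) - aInf) x‖ ≤ (4 + Ca) * δ := by
  have h0 : ContDiff ℝ ∞ fun y : E4 ↦ y 0 := (EuclideanSpace.proj (0 : Fin 4) : E4 →L[ℝ] ℝ).contDiff
  have hap : ContDiff ℝ ∞ fun y : E4 ↦ a (y 0) := ha.comp h0
  have hfd : ContDiff ℝ ∞ (fderiv ℝ A) := hA.fderiv_right (by simp)
  have hprod : ContDiff ℝ ∞ fun y : E4 ↦ (a (y 0)).comp (fderiv ℝ A y) := hap.clm_comp hfd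
  -- norms of `DA` and its derivatives
  have hDA1 : ‖fderiv ℝ A x‖ ≤ 2 := by
    have := norm_add_le (fderiv ℝ A x - ContinuousLinearMap.id ℝ E4) (ContinuousLinearMap.id ℝ E4)
    rw [sub_add_cancel] at this
    linarith [ContinuousLinearMap.norm_id_le (𝕜 := ℝ) (E := E4)]
  have hDAj : ∀ j ≤ 2, ‖iteratedFDeriv ℝ j (fderiv ℝ A) x‖ ≤ if j = 0 then 2 else δ := by
    intro j hj
    rw [norm_iteratedFDeriv_fderiv]
    rcases Nat.eq_zero_or_pos j with h | h
    · subst h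
      rw [if_pos rfl, zero_add, ← norm_iteratedFDeriv_fderiv, norm_iteratedFDeriv_zero]
      exact hDA1
    · rw [if_neg (Nat.pos_iff_ne_zero.mp h)]
      exact hDk (j + 1) (by omega) (by omega)
  have haj : ∀ i ≤ 2, ‖iteratedFDeriv ℝ i (fun y : E4 ↦ a (y 0)) x‖ ≤ if i = 0 then Ca else δ := by
    intro i hi
    refine (norm_iteratedFDeriv_comp_time_le ha x (by exact_mod_cast le_top)).trans ?_
    rcases Nat.eq_zero_or_pos i with h | h
    · subst h; rw [if_pos rfl, iteratedDeriv_zero]; exact ha0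
    · rw [if_neg (Nat.pos_iff_ne_zero.mp h)]; exact hak i h hi
  -- Leibniz for the composition product
  have hleib : ∀ k ≤ 2, ‖iteratedFDeriv ℝ k (fun y ↦ (a (y 0)).comp (fderiv ℝ A y)) x‖ ≤
      ∑ i ∈ Finset.range (k + 1), (k.choose i : ℝ) *
        ‖iteratedFDeriv ℝ i (fun y : E4 ↦ a (y 0)) x‖ * ‖iteratedFDeriv ℝ (k - i) (fderiv ℝ A) x‖ := by
    intro k hk
    have h := (ContinuousLinearMap.compL ℝ E4 E4 E4).norm_iteratedFDeriv_le_of_bilinear_of_le_one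
      (f := fun y : E4 ↦ a (y 0)) (g := fderiv ℝ A) (N := ∞) hap hfd x (n := k)
      (by exact_mod_cast le_top) (ContinuousLinearMap.norm_compL_le _ _ _ _)
    simpa only [ContinuousLinearMap.compL_apply] using h
  intro k hk
  rcases Nat.eq_zero_or_pos k with h | h
  · -- order 0: `a(DA − 1) + (a − aInf)`
    subst h
    rw [norm_iteratedFDeriv_zero]
    have e : (a (x 0)).comp (fderiv ℝ A x) - aInf =
        (a (x 0)).comp (fderiv ℝ A x - ContinuousLinearMap.id ℝ E4) + (a (x 0) - aInf) := by
      ext v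
      simp
    rw [e]
    refine (norm_add_le _ _).trans ?_
    have h1 := ContinuousLinearMap.opNorm_comp_le (a (x 0)) (fderiv ℝ A x - ContinuousLinearMap.id ℝ E4)
    have h2 : ‖a (x 0)‖ * ‖fderiv ℝ A x - ContinuousLinearMap.id ℝ E4‖ ≤ Ca * δ :=
      mul_le_mul ha0 hDA (norm_nonneg _) hCa
    nlinarith
  · -- orders 1, 2: the constant drops
    have hsub : iteratedFDeriv ℝ k (fun y ↦ (a (y 0)).comp (fderiv ℝ A y) - aInf) x =
        iteratedFDeriv ℝ k (fun y ↦ (a (y 0)).comp (fderiv ℝ A y)) x := by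
      have : (fun y ↦ (a (y 0)).comp (fderiv ℝ A y) - aInf) =
          (fun y ↦ (a (y 0)).comp (fderiv ℝ A y)) - fun _ ↦ aInf := rfl
      rw [this, iteratedFDeriv_sub_apply (hprod.contDiffAt.of_le (by exact_mod_cast le_top)) contDiffAt_const,
        iteratedFDeriv_const_of_ne (Nat.pos_iff_ne_zero.mp h)]
      simp
    rw [hsub]
    refine (hleib k hk).trans ?_
    interval_cases k
    · rw [Finset.sum_range_succ, Finset.sum_range_succ, Finset.sum_range_zero, zero_add]
      simp only [Nat.choose_zero_right, Nat.cast_one, one_mul, Nat.sub_zero, Nat.choose_self]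
      have e1 := haj 0 (by norm_num); have e2 := haj 1 (by norm_num)
      have f1 := hDAj 0 (by norm_num); have f2 := hDAj 1 (by norm_num)
      simp only [if_true] at e1 f1
      simp only [one_ne_zero, if_false] at e2 f2
      have p1 : ‖iteratedFDeriv ℝ 0 (fun y : E4 ↦ a (y 0)) x‖ * ‖iteratedFDeriv ℝ 1 (fderiv ℝ A) x‖ ≤
          Ca * δ := mul_le_mul e1 f2 (norm_nonneg _) hCa
      have p2 : ‖iteratedFDeriv ℝ 1 (fun y : E4 ↦ a (y 0)) x‖ * ‖iteratedFDeriv ℝ 0 (fderiv ℝ A) x‖ ≤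
          δ * 2 := mul_le_mul e2 f1 (norm_nonneg _) hδ0
      nlinarith
    · rw [Finset.sum_range_succ, Finset.sum_range_succ, Finset.sum_range_succ, Finset.sum_range_zero,
        zero_add]
      simp only [Nat.choose_zero_right, Nat.cast_one, one_mul, Nat.sub_zero, Nat.choose_self,
        show Nat.choose 2 1 = 2 by rfl]
      have e1 := haj 0 (by norm_num); have e2 := haj 1 (by norm_num); have e3 := haj 2 (by norm_num)
      have f1 := hDAj 0 (by norm_num); have f2 := hDAj 1 (by norm_num); have f3 := hDAj 2 (by norm_num)
      simp only [if_true] at e1 f1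
      simp only [one_ne_zero, if_false] at e2 f2
      simp only [OfNat.ofNat_ne_zero, if_false] at e3 f3
      have p1 : ‖iteratedFDeriv ℝ 0 (fun y : E4 ↦ a (y 0)) x‖ * ‖iteratedFDeriv ℝ 2 (fderiv ℝ A) x‖ ≤
          Ca * δ := mul_le_mul e1 f3 (norm_nonneg _) hCa
      have p2 : ‖iteratedFDeriv ℝ 1 (fun y : E4 ↦ a (y 0)) x‖ * ‖iteratedFDeriv ℝ 1 (fderiv ℝ A) x‖ ≤
          δ * δ := mul_le_mul e2 f2 (norm_nonneg _) hδ0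
      have p3 : ‖iteratedFDeriv ℝ 2 (fun y : E4 ↦ a (y 0)) x‖ * ‖iteratedFDeriv ℝ 0 (fderiv ℝ A) x‖ ≤
          δ * 2 := mul_le_mul e3 f1 (norm_nonneg _) hδ0
      push_cast
      nlinarith

/-! ### The model defect -/

/-- **The model defect** `T = K[(Λ + E) ·, (Λ + E) ·] − K[Λ ·, Λ ·]` in `Cᵏ` (`k ≤ 2`): if
`‖Dⁱ K(x')‖ ≤ C_K` and `‖Dⁱ E(x')‖ ≤ ε ≤ C_E` for `i ≤ k`, then
`‖Dᵏ T(x')‖ ≤ 4ᵏ C_K ε (2‖Λ‖ + C_E)` (expand `T = K[E, Λ] + K[Λ, E] + K[E, E]`, trilinear Leibniz).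
[folklore] -/
theorem norm_iteratedFDeriv_modelDefect_le' {K : E4 → E4 →L[ℝ] E4 →L[ℝ] ℝ} {E : E4 → E4 →L[ℝ] E4}
    {W : Set E4} (hW : IsOpen W) (hK : ContDiffOn ℝ ∞ K W) (hE : ContDiff ℝ ∞ E) (Λ : E4 →L[ℝ] E4)
    {x : E4} (hx : x ∈ W) (k : ℕ) {CK ε CE : ℝ} (hCK : ∀ i ≤ k, ‖iteratedFDeriv ℝ i K x‖ ≤ CK)
    (hε : ∀ i ≤ k, ‖iteratedFDeriv ℝ i E x‖ ≤ ε) (hεE : ε ≤ CE) :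
    ‖iteratedFDeriv ℝ k (fun y ↦ (K y).bilinearComp (Λ + E y) (Λ + E y) -
        (K y).bilinearComp Λ Λ) x‖ ≤ 4 ^ k * CK * ε * (2 * ‖Λ‖ + CE) := by
  have hε0 : 0 ≤ ε := (norm_nonneg _).trans (hε 0 (Nat.zero_le _))
  have hCK0 : 0 ≤ CK := (norm_nonneg _).trans (hCK 0 (Nat.zero_le _))
  have hKx : ContDiffAt ℝ ∞ K x := (hK x hx).contDiffAt (hW.mem_nhds hx)
  -- the expansion
  have hfun : (fun y ↦ (K y).bilinearComp (Λ + E y) (Λ + E y) - (K y).bilinearComp Λ Λ) =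
      (fun y ↦ (K y).bilinearComp (E y) Λ) + (fun y ↦ (K y).bilinearComp Λ (E y)) +
        fun y ↦ (K y).bilinearComp (E y) (E y) := by
    funext y
    simp only [Pi.add_apply]
    ext u w
    simp only [ContinuousLinearMap.bilinearComp_apply, sub_apply, add_apply, map_add]
    ring
  -- smoothness of the three pieces at `x`
  have hcd : ∀ P Q : E4 → E4 →L[ℝ] E4, ContDiff ℝ ∞ P → ContDiff ℝ ∞ Q →
      ContDiffAt ℝ k (fun y ↦ (K y).bilinearComp (P y) (Q y)) x := by
    intro P Q hP hQ
    have h2 : ContDiffAt ℝ ∞ (fun y ↦ (K y).comp (P y)) x := hKx.clm_comp hP.contDiffAt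
    have h3 := ContDiffAt.continuousLinearMap_comp (G := (E4 →L[ℝ] ℝ) →L[ℝ] (E4 →L[ℝ] ℝ))
      ((ContinuousLinearMap.compL ℝ E4 E4 ℝ).flip) hQ.contDiffAt (x := x)
    have h4 := h3.clm_comp h2
    have hfun : (fun y ↦ (K y).bilinearComp (P y) (Q y)) =
        fun y ↦ ((ContinuousLinearMap.compL ℝ E4 E4 ℝ).flip (Q y)).comp ((K y).comp (P y)) := by
      funext y; ext u w; simp
    rw [hfun]
    exact h4.of_le (by exact_mod_cast le_top)
  have hΛc : ContDiff ℝ ∞ fun _ : E4 ↦ Λ := contDiff_const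
  have hΛb : ∀ i ≤ k, ‖iteratedFDeriv ℝ i (fun _ : E4 ↦ Λ) x‖ ≤ ‖Λ‖ := by
    intro i hi
    rcases Nat.eq_zero_or_pos i with h | h
    · subst h; rw [norm_iteratedFDeriv_zero]
    · rw [iteratedFDeriv_const_of_ne (Nat.pos_iff_ne_zero.mp h)]; simp
  have t1 := norm_iteratedFDeriv_bilinearComp_le_of_bounds hW hK hE hΛc hx k hCK hε hΛb
  have t2 := norm_iteratedFDeriv_bilinearComp_le_of_bounds hW hK hΛc hE hx k hCK hΛb hε
  have t3 := norm_iteratedFDeriv_bilinearComp_le_of_bounds hW hK hE hE hx k hCK hε hε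
  have h12 : ContDiffAt ℝ k ((fun y ↦ (K y).bilinearComp (E y) Λ) +
      fun y ↦ (K y).bilinearComp Λ (E y)) x := (hcd _ _ hE hΛc).add (hcd _ _ hΛc hE)
  rw [hfun, iteratedFDeriv_add_apply h12 (hcd _ _ hE hE),
    iteratedFDeriv_add_apply (hcd _ _ hE hΛc) (hcd _ _ hΛc hE)]
  refine (norm_add_le _ _).trans ?_
  refine (add_le_add ((norm_add_le _ _).trans (add_le_add t1 t2)) t3).trans ?_
  have h1 : (4 : ℝ) ^ k * CK * ε * ε ≤ 4 ^ k * CK * ε * CE :=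
    mul_le_mul_of_nonneg_left hεE (by positivity)
  nlinarith [h1, norm_nonneg Λ]

/-! ### Registered forms -/

/-- Registered sub-goal form (stub `norm_iteratedFDeriv_frameDefect_le` of the crux item) of
`norm_iteratedFDeriv_frameDefect_le'`. [folklore] -/
theorem norm_iteratedFDeriv_frameDefect_le : ∀ {a : ℝ → E4 →L[ℝ] E4} {A : E4 → E4}, ContDiff ℝ ((⊤ : ℕ∞) : WithTop ℕ∞) a → ContDiff ℝ ((⊤ : ℕ∞) : WithTop ℕ∞) A → ∀ (aInf : E4 →L[ℝ] E4) {x : E4} {δ Ca : ℝ}, 0 ≤ δ → δ ≤ 1 → 0 ≤ Ca → ‖fderiv ℝ A x - ContinuousLinearMap.id ℝ E4‖ ≤ δ → (∀ j, 2 ≤ j → j ≤ 3 → ‖iteratedFDeriv ℝ j A x‖ ≤ δ) → ‖a (x 0)‖ ≤ Ca → ‖a (x 0) - aInf‖ ≤ δ → (∀ i, 1 ≤ i → i ≤ 2 → ‖iteratedDeriv i a (x 0)‖ ≤ δ) → ∀ k ≤ 2, ‖iteratedFDeriv ℝ k (fun y ↦ (a (y 0)).comp (fderiv ℝ A y) -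 aInf) x‖ ≤ (4 + Ca) * δ :=
  fun ha hA aInf _ _ _ hδ0 hδ1 hCa hDA hDk ha0 haV hak ↦
    norm_iteratedFDeriv_frameDefect_le' ha hA aInf hδ0 hδ1 hCa hDA hDk ha0 haV hak

/-- Registered sub-goal form (stub `norm_iteratedFDeriv_modelDefect_le` of the crux item) of
`norm_iteratedFDeriv_modelDefect_le'`. [folklore] -/
theorem norm_iteratedFDeriv_modelDefect_le : ∀ {K : E4 → E4 →L[ℝ] E4 →L[ℝ] ℝ} {E : E4 → E4 →L[ℝ] E4} {W : Set E4}, IsOpen W → ContDiffOn ℝ ((⊤ : ℕ∞) : WithTop ℕ∞) K W → ContDiff ℝ ((⊤ : ℕ∞) : WithTop ℕ∞) E → ∀ (Λ : E4 →L[ℝ] E4) {x : E4}, x ∈ W → ∀ (k : ℕ) {CK ε CE : ℝ}, (∀ i ≤ k, ‖iteratedFDeriv ℝ i K x‖ ≤ CK) → (∀ i ≤ k, ‖iteratedFDeriv ℝ i E x‖ ≤ ε) → ε ≤ CE → ‖iteratedFDeriv ℝ k (fun y ↦ (K y).bilinearComp (Λ + E y) (Λ + E y) - (K y).bilinearComp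 Λ Λ) x‖ ≤ 4 ^ k * CK * ε * (2 * ‖Λ‖ + CE) :=
  fun hW hK hE Λ _ hx k _ _ _ hCK hε hεE ↦ norm_iteratedFDeriv_modelDefect_le' hW hK hE Λ hx k hCK hε hεE

end Summit.FinalStateConjecture.FinalStateConjecture.Theorems

end
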